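import Summits.BirchSwinnertonDyer.BirchSwinnertonDyer.Theorems.KolyvaginRankRigidityAtTwoChebotarevWindowPrimeAtTwo
import Summits.BirchSwinnertonDyer.BirchSwinnertonDyer.Theorems.KolyvaginRankRigidityAtTwoOffHabitatIrredChebotarevOneClass
import Summits.BirchSwinnertonDyer.BirchSwinnertonDyer.Theorems.KolyvaginRankRigidityAtTwoOffHabitatIrredChebotarevPairFiniteIndex
import Summits.BirchSwinnertonDyer.BirchSwinnertonDyer.Theorems.KolyvaginRankRigidityAtTwoOffHabitatIrredConjSign
import Literature.NumberTheory.EllipticCurves.ArtinFormalismQuadraticLocalProofs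
import Literature.NumberTheory.EllipticCurves.BSDSelmerParityDokchitserBaseChangeProofs
import HarnessLib

/-!
# Route `KolyvaginRankRigidityAtTwo`, residual crux R_irr `OffHabitatIrredNonSurjTwoConverse`
# (stmt-BirchSwinnertonDyer-27123, LINE 8∞): the WINDOW-PRIME supply and the S2-shaped index-raising
# Čebotarev OFF THE HABITAT (order-free currency, defect `k + 1`) — the engine interfaces
# (helper, PROVED modulo the named fact `serre_adicImage_contains_congruenceSubgroup` where stated;
# width seat `bsd-line-krr2-p2` g9)

The KRR swap engine S1L (`primeSwapAtTwoLossy_of_namedFacts`) and V2♭∞ / U2 consume the Čebotarev supply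
through three habitat interfaces: S2 `stub_chebotarevOneClassIndexAtTwo` (`∃ c₁`, Kolyvagin-class currency,
index raising `M ≤ I`), `exists_kolyvaginPrime_notMem_of_heegner` (order-free one class: `2^{j+2} κ ≠ 0 ⇒ 2^j κ ∉ ker loc_v`)
and `exists_kolyvaginPrime_notMem_pair_frob` (order-free pair with `Frob q = Frob ∞`). This file gives the
three with the `2`-adic image replaced by the finite-index inputs (`hSah` defect `k`, `hS`), in the ORDER-FREE
currency with defect `D = k + 1` (`2^{j+k+1} κ ≠ 0 ⇒ 2^j κ ∉ ker loc_v`):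

* `orderFree_of_exponent_defect` — exponent bookkeeping for any defect `D`;
* `exists_kolyvaginPrime_notMem_orderFree_of_inflationDefect` (one class), `…_pair_orderFree_of_inflationDefect`,
  `…_pair_frob_of_inflationDefect` (two classes, with / without the Frobenius conclusion);
* **`chebotarevOneClassIndexAtTwo_offHabitat`** — the TEXT of S2 `stub_chebotarevOneClassIndexAtTwo` with the
  binder `(∀ m, ρ̄_{E,2^m} onto)` replaced by `E(ℚ)[2] = 0`, `∃ c₁` (namely `c₁ = k + 1`, `k` from
  `inflationDefect_of_serre`), using the off-habitat T3 `conjSign_offHabitat` for the eigen-sign — CONDITIONAL on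
  the named fact `serre_adicImage_contains_congruenceSubgroup` (explicit hypothesis).

These are the exact plug-in points for re-threading S1L / V2irr / U2irr (LINE 8∞ stubs
`stub_corankLowerBoundAtTwoRichIrr`, U2irr): `obtain ⟨c₁, hS2⟩ := chebotarevOneClassIndexAtTwo_offHabitat hSerre …`
replaces the habitat S2 call verbatim.

HONEST FRAMING: helper lemmas (`--supports` 27123); nothing here closes R_irr or its stubs; BSD is NOT proved.

References: [McCallumLMS1991] §3 Cor. 3.2, §5 (proof of Prop. 5.2); [Kolyvagin1991MathAnn] §2 (ref. [1] Prop. 8);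
[WZhang2014] Notations (xii); [SilvermanAEC2009] Thm. III.7.9 (a).
-/

set_option autoImplicit false
-- the Theorems namespace of this sub repeats the summit name by design (D-0017 nested layout)
set_option linter.dupNamespace false

noncomputable section

open scoped Classical

namespace Summit.BirchSwinnertonDyer.BirchSwinnertonDyer.Theorems.KolyvaginLowerBoundAtTwo

open WeierstrassCurve Field NumberField IsDedekindDomain
open Literature.NumberTheory.GaloisRepresentations Literature.NumberTheory.EllipticCurves
open Literature.NumberTheory Literature.NumberTheory.EllipticCurves.ModularForms

section WindowPrime

variable (W : WeierstrassCurve ℚ) (K : Type) [Field K] [NumberField K]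

/-- From the exponent of a class to the order-free local statement with defect `D`: if `2^m κ = 0` and
`P j` for `j + D + 1 ≤ m`, then `2^{j+D} κ ≠ 0 ⟹ P j`. [folklore] -/
theorem orderFree_of_exponent_defect {M : ℕ} {κ : galH1Torsion (W.baseChange K) ((2 ^ M : ℕ) : ℤ)}
    {m : ℕ} (hkill : (2 : ℤ) ^ m • κ = 0) (D : ℕ) {P : ℕ → Prop} (hP : ∀ j : ℕ, j + D + 1 ≤ m → P j) :
    ∀ j : ℕ, ((2 ^ (j + D) : ℕ) : ℤ) • κ ≠ 0 → P j := by
  intro j hj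
  apply hP
  by_contra hlt
  apply hj
  have : ((2 ^ (j + D) : ℕ) : ℤ) • κ = (2 : ℤ) ^ (j + D - m) • ((2 : ℤ) ^ m • κ) := by
    rw [smul_smul, ← pow_add, Nat.sub_add_cancel (by omega)]; push_cast; rfl
  rw [this, hkill, zsmul_zero]

variable {W K}

/-- **New window prime at `2` for ONE eigenclass at finite `2`-adic index, order-free** (defect `k + 1`):
for `κ ∈ H¹(K, E[2^M])` with `c_* κ = ε κ`, `M ≤ M'`, inflation defect `≤ k` bits and `E[2]` simple over
`K`, for every finite `S` there is a Kolyvagin prime `q ∉ S` at `2` with `M' ≤ M(q)` and a place `v ∋ q` where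
`2^j κ ∉ ker loc_v` whenever `2^{j+k+1} κ ≠ 0`. [cite: McCallumLMS1991, §3 Cor. 3.2]
[cite: Kolyvagin1991MathAnn, §2 (ref. [1] Prop. 8)] -/
theorem exists_kolyvaginPrime_notMem_orderFree_of_inflationDefect [W.IsElliptic] [W.IsGloballyMinimal]
    [NeZero (W.conductorNorm ℤ)] (hK : IsImaginaryQuadratic K)
    (hS : ∀ H : AddSubgroup (geomTorsion (W.baseChange K) 2),
      (∀ g : absoluteGaloisGroup K, ∀ t ∈ H, g • t ∈ H) → H = ⊥ ∨ H = ⊤)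
    {c : K ≃ₐ[ℚ] K} (hc : c ≠ 1) {M M' : ℕ} (hM : 1 ≤ M) (hMM' : M ≤ M') {k : ℕ}
    (hSah : ∀ x : galH1Torsion (W.baseChange K) ((2 ^ M : ℕ) : ℤ),
      (∀ g ∈ torsionFixing (W.baseChange K) ((2 ^ M' : ℕ) : ℤ),
        h1Eval (W.baseChange K) ((2 ^ M : ℕ) : ℤ) x g = 0) → (2 : ℤ) ^ k • x = 0)
    (κ : galH1Torsion (W.baseChange K) ((2 ^ M : ℕ) : ℤ)) {ε : ℤ} (hε : ε = 1 ∨ ε = -1)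
    (hκ : conjAct W c ((2 ^ M : ℕ) : ℤ) κ = ε • κ) (S : Finset ℕ) :
    ∃ q : ℕ, q ∉ S ∧ Zhang2014.IsKolyvaginPrime (W.conductorNorm ℤ) W K 2 q ∧
      M' ≤ Zhang2014.kolyvaginIndex W 2 q ∧
      ∃ v : HeightOneSpectrum (𝓞 K), ((q : ℕ) : 𝓞 K) ∈ v.asIdeal ∧
        ∀ j : ℕ, ((2 ^ (j + (k + 1)) : ℕ) : ℤ) • κ ≠ 0 →
          ((2 ^ j : ℕ) : ℤ) • κ ∉
            (W.baseChange K).torsionLocalKer (v.adicCompletion K) ((2 ^ M : ℕ) : ℤ) := by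
  classical
  have hM' : 1 ≤ M' := hM.trans hMM'
  by_cases hκ0 : κ = 0
  · obtain ⟨q, hbq, hkoly, hidx, -⟩ := exists_kolyvaginPrime_gt_le_kolyvaginIndex (W := W)
      (N := W.conductorNorm ℤ) hK hc hM' (S.sup id)
    have hqS : q ∉ S := fun h ↦ by
      have := Finset.le_sup (f := id) h
      simp only [id_eq] at this
      omega
    obtain ⟨v, hv⟩ := exists_natCast_mem_of_isKolyvaginPrime (W := W) hkoly
    refine ⟨q, hqS, hkoly, hidx, v, hv, fun j hj ↦ absurd ?_ hj⟩
    rw [hκ0, zsmul_zero]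
  · obtain ⟨m, hkill, hm⟩ := exists_exponent_two W K hκ0
    have hinf := setInfinite_kolyvaginPrime_two_eigenclass_of_inflationDefect (N := W.conductorNorm ℤ) hK hS
      hc hM hMM' hSah κ hε hκ hm
    obtain ⟨q, hq⟩ := (hinf.sdiff S.finite_toSet).nonempty
    obtain ⟨⟨hkoly, hidx, -, hloc⟩, hqS⟩ := hq
    obtain ⟨v, hv⟩ := exists_natCast_mem_of_isKolyvaginPrime (W := W) hkoly
    exact ⟨q, hqS, hkoly, hidx, v, hv,
      orderFree_of_exponent_defect W K hkill (k + 1) (fun j hj ↦ hloc v hv j (by omega))⟩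

/-- **New window prime at `2` for TWO eigenclasses at finite `2`-adic index, order-free** (defect `k + 1`
for each class). [cite: McCallumLMS1991, §5 (proof of Prop. 5.2)] [cite: Kolyvagin1991MathAnn, §2 (ref. [1] Prop. 8)] -/
theorem exists_kolyvaginPrime_notMem_pair_orderFree_of_inflationDefect [W.IsElliptic] [W.IsGloballyMinimal]
    [NeZero (W.conductorNorm ℤ)] (hK : IsImaginaryQuadratic K)
    (hS : ∀ H : AddSubgroup (geomTorsion (W.baseChange K) 2),
      (∀ g : absoluteGaloisGroup K, ∀ t ∈ H, g • t ∈ H) → H = ⊥ ∨ H = ⊤)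
    {c : K ≃ₐ[ℚ] K} (hc : c ≠ 1) {M M' : ℕ} (hM : 1 ≤ M) (hMM' : M ≤ M') {k : ℕ}
    (hSah : ∀ x : galH1Torsion (W.baseChange K) ((2 ^ M : ℕ) : ℤ),
      (∀ g ∈ torsionFixing (W.baseChange K) ((2 ^ M' : ℕ) : ℤ),
        h1Eval (W.baseChange K) ((2 ^ M : ℕ) : ℤ) x g = 0) → (2 : ℤ) ^ k • x = 0)
    (κ₁ κ₂ : galH1Torsion (W.baseChange K) ((2 ^ M : ℕ) : ℤ)) (h1 : κ₁ ≠ 0) (h2 : κ₂ ≠ 0)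
    {ε₁ ε₂ : ℤ} (hε₁ : ε₁ = 1 ∨ ε₁ = -1) (hε₂ : ε₂ = 1 ∨ ε₂ = -1)
    (hκ₁ : conjAct W c ((2 ^ M : ℕ) : ℤ) κ₁ = ε₁ • κ₁)
    (hκ₂ : conjAct W c ((2 ^ M : ℕ) : ℤ) κ₂ = ε₂ • κ₂) (S : Finset ℕ) :
    ∃ q : ℕ, q ∉ S ∧ Zhang2014.IsKolyvaginPrime (W.conductorNorm ℤ) W K 2 q ∧
      M' ≤ Zhang2014.kolyvaginIndex W 2 q ∧ FrobEqFrobInfty W K (2 ^ M') q ∧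
      ∃ v : HeightOneSpectrum (𝓞 K), ((q : ℕ) : 𝓞 K) ∈ v.asIdeal ∧
        (∀ j : ℕ, ((2 ^ (j + (k + 1)) : ℕ) : ℤ) • κ₁ ≠ 0 →
          ((2 ^ j : ℕ) : ℤ) • κ₁ ∉
            (W.baseChange K).torsionLocalKer (v.adicCompletion K) ((2 ^ M : ℕ) : ℤ)) ∧
        (∀ j : ℕ, ((2 ^ (j + (k + 1)) : ℕ) : ℤ) • κ₂ ≠ 0 →
          ((2 ^ j : ℕ) : ℤ) • κ₂ ∉
            (W.baseChange K).torsionLocalKer (v.adicCompletion K) ((2 ^ M : ℕ) : ℤ)) := by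
  classical
  obtain ⟨m₁, hkill₁, hm₁⟩ := exists_exponent_two W K h1
  obtain ⟨m₂, hkill₂, hm₂⟩ := exists_exponent_two W K h2
  obtain ⟨q, hbq, hkoly, hidx, hfrob, hloc⟩ :=
    exists_kolyvaginPrime_gt_two_eigenclass_pair_of_inflationDefect (N := W.conductorNorm ℤ) hK hS hc hM hMM'
      hSah κ₁ κ₂ hε₁ hε₂ hκ₁ hκ₂ hm₁ hm₂ (S.sup id)
  have hqS : q ∉ S := fun h ↦ by
    have := Finset.le_sup (f := id) h
    simp only [id_eq] at this
    omega
  obtain ⟨v, hv⟩ := exists_natCast_mem_of_isKolyvaginPrime (W := W) hkoly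
  exact ⟨q, hqS, hkoly, hidx, hfrob, v, hv,
    orderFree_of_exponent_defect W K hkill₁ (k + 1) (fun j hj ↦ (hloc v hv).1 j (by omega)),
    orderFree_of_exponent_defect W K hkill₂ (k + 1) (fun j hj ↦ (hloc v hv).2 j (by omega))⟩

end WindowPrime

/-! ### S2 off the habitat: index-raising one-class Čebotarev in Kolyvagin-class currency, `∃ c₁` -/

/-- **S2 OFF THE HABITAT** — the text of the registered habitat stub `stub_chebotarevOneClassIndexAtTwo`
(`∃ c₁`, Kolyvagin-class currency, index raising `M ≤ I`) with the binder `(∀ m, ρ̄_{E,2^m} onto)` replaced by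
`E(ℚ)[2] = 0`: witnessed by `c₁ = k + 1`, `k` the uniform inflation defect of `inflationDefect_of_serre`,
with `E[2]` simple from `simple_two_of_torsionBy_eq_bot` and the eigen-sign from the off-habitat T3
`conjSign_offHabitat`. CONDITIONAL on the named fact `serre_adicImage_contains_congruenceSubgroup` (Serre's
open image theorem, in print). This is the plug-in replacement of S2 for the re-threading of S1L / V2irr / U2irr.
[cite: McCallumLMS1991, §3 Cor. 3.2] [cite: Kolyvagin1991MathAnn, §2 (proof of Thm. 2.2)]
[cite: WZhang2014, Notations (xii)] [cite: SilvermanAEC2009, Thm. III.7.9 (a)] -/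
theorem chebotarevOneClassIndexAtTwo_offHabitat (hSerre : serre_adicImage_contains_congruenceSubgroup) :
    ∀ (W : WeierstrassCurve ℚ) [W.IsElliptic] [W.IsGloballyMinimal], ¬ W.HasCM →
      (Rank1Residual.GoodOrd W 2 ∨ Rank1Residual.Mult W 2) →
      AddSubgroup.torsionBy W.toAffine.Point (2 : ℤ) = ⊥ →
      ∀ (K : Type) [Field K] [NumberField K], IsImaginaryQuadratic K → NumberField.discr K ≠ -3 →
      NumberField.discr K ≠ -4 → ¬ ((2 : ℤ) ∣ NumberField.discr K) → ∀ [NeZero (W.conductorNorm ℤ)],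
      SatisfiesHeegnerHypothesis (W.conductorNorm ℤ) K →
      ∃ c₁ : ℕ, ∀ (Dt : ModularParametrizationData W (W.conductorNorm ℤ)) (β : ℤ) (ι : K →+* ℂ),
        ∀ (n : ℕ) (dat : KolyvaginHeegnerData Dt β ι n) (M m I : ℕ),
        KolyvaginDescent.KolSupp (Zhang2014.IsKolyvaginPrime (W.conductorNorm ℤ) W K 2) n → 1 ≤ M →
        (M : ℕ∞) ≤ Zhang2014.levelIndex W 2 n → M ≤ I → c₁ ≤ m →
        ((2 ^ m : ℕ) : ℤ) • dat.kolyvaginClass Nat.prime_two M ≠ 0 →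
        (∀ X' : Finset ℕ, ∃ q : ℕ, q ∉ X' ∧ Zhang2014.IsKolyvaginPrime (W.conductorNorm ℤ) W K 2 q ∧
          I ≤ Zhang2014.kolyvaginIndex W 2 q ∧
          ∃ v : HeightOneSpectrum (𝓞 K), ((q : ℕ) : 𝓞 K) ∈ v.asIdeal ∧
            ((2 ^ (m - c₁) : ℕ) : ℤ) • dat.kolyvaginClass Nat.prime_two M ∉
              (W.baseChange K).torsionLocalKer (v.adicCompletion K) ((2 ^ M : ℕ) : ℤ)) := by
  intro W _ _ hCM hred htorQ K _ _ hK hne3 hne4 h2d _ hHN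
  obtain ⟨k, hk⟩ := inflationDefect_of_serre hSerre W hCM K hK.1
  have hS := simple_two_of_torsionBy_eq_bot W htorQ K hK
  refine ⟨k + 1, fun Dt β ι n dat M m I hn hM1 hMle hMI hm hne X' ↦ ?_⟩
  -- the non-trivial automorphism of `K` and the eigen-sign of `c_M(n)` (off-habitat T3)
  obtain ⟨θ, hθ, hcθ⟩ := exists_sq_eq_discr_not_mem_range K hK.1
  have hσ₀1 : sigmaQ K hK.1 hθ hcθ ≠ 1 := sigmaQ_ne_one K hK.1 hθ hcθ
  obtain ⟨ε, hε1, hT3⟩ := conjSign_offHabitat W hCM hred htorQ K hK hne3 hne4 h2d hHN Dt β ι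
    (sigmaQ K hK.1 hθ hcθ) hσ₀1 n.primeFactors.card
  have hκ := hT3 n dat M hn rfl hM1 hMle
  obtain ⟨q, hqX, hkoly, hidx, v, hv, hloc⟩ :=
    exists_kolyvaginPrime_notMem_orderFree_of_inflationDefect hK hS hσ₀1 hM1 hMI (hk M I hMI)
      (dat.kolyvaginClass Nat.prime_two M) hε1 hκ X'
  refine ⟨q, hqX, hkoly, hidx, v, hv, hloc (m - (k + 1)) ?_⟩
  rwa [Nat.sub_add_cancel hm]

end Summit.BirchSwinnertonDyer.BirchSwinnertonDyer.Theorems.KolyvaginLowerBoundAtTwo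

end
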